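import Summits.HodgeConjecture.CorCM.PrimeSlotsSplitOffHodge
import Summits.HodgeConjecture.CorCM.CMAbelianFactorsDimLeThreeClassification
import HarnessLib

/-!
# Complex abelian varieties of CM type whose simple isogeny factors have dimension `≤ 3` OR PRIME: the classification of
# `CorCM/CMAbelianFactorsDimLeThreeClassification` holds VERBATIM once the prime-dimensional factors of dimension `≥ 5`
# have pairwise distinct dimensions — (i′) no imaginary quadratic field in two non-isogenous simple factors, (ii′) at most
# three isogeny classes of simple threefolds per endomorphism field, (iii′) at most two isogeny classes of simple surfaces
# per Galois closure

COR-CM (cell `pub-hodgecm2`, binder seat `b16` gen 46, count-neutral claim PRIME-SLOT, file F6 — the INTRINSIC classification;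
theorems only, no definition, no named fact, no `sorry`).  NEW as stated (an assembly of tree theorems), hence under
`Summits/`.  HONEST FRAMING: an unconditional classification theorem for complex abelian varieties of CM type, read on the
variety; not a step of the summit chain (`HC_CM` is neither used nor advanced).

THE THEOREM (`forall_isDivisorGenerated_powSucc_iff_of_isOfCMType_of_factors_prime_or_dim_le_three`).  Let `X` be a complex
abelian variety of CM type (`Milne1999.IsOfCMType X`) each of whose SIMPLE ISOGENY FACTORS (`B` simple with
`Domination.AVDominatedBy B X`) has dimension `≤ 3` or PRIME dimension (`5, 7, 11, …`), two non-isogenous prime-dimensional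
factors of dimension `≥ 5` never having the same dimension.  Then EVERY POWER `X^{N+1}` is divisor-generated
(`B• = D• ⊗ ℂ`) IF AND ONLY IF the three conditions of this seat's gen-44 classification hold:

* (i′) NO two non-isogenous simple isogeny factors `B`, `B′` of positive dimension and an imaginary quadratic number field `k`
  with ring maps `k → End⁰(B)`, `k → End⁰(B′)`;
* (ii′) NO four pairwise non-isogenous simple THREEFOLD factors with pairwise isomorphic endomorphism algebras;
* (iii′) NO three pairwise non-isogenous simple SURFACE factors whose endomorphism fields have one intrinsic Galois
  closure `⨆_{f : End⁰(S) →+* ℂ} ℚ(range f) ≤ ℂ`.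

So a simple factor of prime dimension `p ≥ 5` interacts with the rest ONLY through (i′): the prime slots split off
(`CorCM/PrimeSlotsSplitOffHodge`, on `CorCM/PrimeDegreeSlotPairsHodge`: Cauchy's element of order `p` fixes every smaller
slot and cycles the `p` pairs, so a common constituent is a shared sign character = a shared imaginary quadratic field,
`CorCM/SharedSignCharacterQuadraticSubfield`), and are themselves nondegenerate (Yanai).  New dimension patterns, all
dimensions: `5 + (≤3)s`, `7 + (≤3)s`, `5 + 7 + (≤3)s`, `11 + …`; e.g. `dim X = 8 = 5 + 3`, `= 5 + 2 + 1`, `= 7 + 1`;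
`dim X = 10 = 7 + 3`, `= 5 + 3 + 2`, ….

* §1 `isDivisorGenerated_of_avDominatedBy_powSucc_of_isOfCMType_of_factors_prime_or_dim_le_three` (MASTER: everything
  dominated by a power is divisor-generated), `hodgeConjectureFor_…` (the Hodge conjecture there, UNCONDITIONALLY), the iff,
  the dichotomy `exists_not_isDivisorGenerated_powSucc_iff_…` (the three configurations are the ONLY sources of exotic Hodge
  classes on powers), and the class-target display `hcOnClass_…`.

## References

* [MoonenZarhin1999LowDim] B. Moonen, Yu. Zarhin, *Hodge classes on abelian varieties of low dimension*, Math. Ann. 315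
  (1999) 711–733, Thms. (0.1), (0.2); §3 (3.1), (3.9).
* [Gordon1999HodgeAVSurvey] B. B. Gordon, *A survey of the Hodge conjecture for abelian varieties*, §3 Theorem, 6.3 Remark
  (Yanai), 7.5–7.7, 9.4, 10.10.
* [MumfordAV1970] D. Mumford, *Abelian Varieties*, §19 Thm. 1, Cor. 1–2.
* [Milne1999LefschetzClasses] J. S. Milne, *Lefschetz classes on abelian varieties*, Duke Math. J. 96 (1999), §1 Prop. 1.1.
-/

noncomputable section

open CategoryTheory CategoryTheory.Limits NumberField Module IntermediateField
open scoped BigOperators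

namespace Summit.HodgeConjecture.CorCM

open Literature.NumberTheory.ComplexMultiplication
open Literature.AlgebraicGeometry.Motives (AbelianVariety CMType)
open Literature.AlgebraicGeometry.Motives.AbelianVariety
open Literature.AlgebraicGeometry.HodgeTheory
open Literature.AlgebraicGeometry.ComplexMultiplication (IsCMTypeRealisation)
open Literature.AlgebraicGeometry.VanGeemen1994 (hodgeClassSpan)
open Literature.AlgebraicGeometry.Milne1999
open Literature.AlgebraicGeometry.Pohlmann1968
open Literature.Barriers.HodgeConjecture (divisorClassesSpan)
open Summit.HodgeConjecture.CorCM.Domination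
open Summit.HodgeConjecture.HodgeConjecture.Ring2.ClassTargets (HCOnClass)
open Summit.HodgeConjecture.HodgeConjecture.Ring2.Atlas (nonempty_ringEquiv_endAlgebra_of_isSimple)

variable {X : AbelianVariety ℂ}

/-- A ring isomorphism of number fields preserves the degree. [folklore] -/
private theorem finrank_eq_of_ringEquiv'' {K K' : Type} [Field K] [NumberField K] [Field K'] [NumberField K']
    (e : K ≃+* K') : finrank ℚ K = finrank ℚ K' :=
  (AlgEquiv.ofRingEquiv (f := e) fun q => by rw [eq_ratCast]; exact map_ratCast e q).toLinearEquiv.finrank_eq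

section PrimeOrSmall

open scoped Classical in
/-- **MASTER FORM.**  Let `X` be a complex abelian variety of CM type each of whose simple isogeny factors has dimension `≤ 3`
or prime dimension, the prime-dimensional factors of dimension `≥ 5` having pairwise distinct dimensions (up to isogeny), and
satisfying (i′), (ii′), (iii′) of the module docstring.  Then every complex abelian variety `B` dominated by a power `X^{N+1}`
is divisor-generated.  (Reduction of gen 44 §1: a family of simple, pairwise non-isogenous factors of `X` is nondegenerate by
`isNondegenerateFamily_iff_of_primeFactors_dim_le_three` — the prime slots split off, and the small slots satisfy the gen-43
census —, the hypotheses being read through `End⁰ ≅ K` (Shimura §5.1).) UNCONDITIONAL.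
[cite: MoonenZarhin1999LowDim, Thms. (0.1), (0.2) (4) and §3] [cite: Gordon1999HodgeAVSurvey, 6.3 Remark, 7.5–7.7 and 9.4]
[cite: Shimura1998, §5.1 Props. 3–6 and §8.4] -/
theorem isDivisorGenerated_of_avDominatedBy_powSucc_of_isOfCMType_of_factors_prime_or_dim_le_three (hcm : IsOfCMType X)
    (h35 : ∀ B : AbelianVariety ℂ, B.IsSimple → AVDominatedBy B X → B.dim ≤ 3 ∨ (B.dim.Prime ∧ 5 ≤ B.dim))
    (hdist : ∀ B B' : AbelianVariety ℂ, B.IsSimple → B'.IsSimple → AVDominatedBy B X → AVDominatedBy B' X →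
      5 ≤ B.dim → 5 ≤ B'.dim → ¬ IsIsogenous B B' → B.dim ≠ B'.dim)
    (hi : ¬ ∃ (B B' : AbelianVariety ℂ) (k : Type) (_ : Field k) (_ : NumberField k),
      B.IsSimple ∧ B'.IsSimple ∧ 0 < B.dim ∧ 0 < B'.dim ∧ AVDominatedBy B X ∧ AVDominatedBy B' X ∧
      ¬ IsIsogenous B B' ∧ IsTotallyComplex k ∧ finrank ℚ k = 2 ∧
      Nonempty (k →+* B.endAlgebra) ∧ Nonempty (k →+* B'.endAlgebra))
    (hii : ¬ ∃ T : Fin 4 → AbelianVariety ℂ, (∀ a, (T a).IsSimple ∧ (T a).dim = 3 ∧ AVDominatedBy (T a) X) ∧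
      (∀ a b, a ≠ b → ¬ IsIsogenous (T a) (T b)) ∧ ∀ a b, Nonempty ((T a).endAlgebra ≃+* (T b).endAlgebra))
    (hiii : ¬ ∃ S : Fin 3 → AbelianVariety ℂ, (∀ a, (S a).IsSimple ∧ (S a).dim = 2 ∧ AVDominatedBy (S a) X) ∧
      (∀ a b, a ≠ b → ¬ IsIsogenous (S a) (S b)) ∧
      ∀ a b, (⨆ f : (S a).endAlgebra →+* ℂ, IntermediateField.adjoin ℚ (Set.range f)) =
        ⨆ f : (S b).endAlgebra →+* ℂ, IntermediateField.adjoin ℚ (Set.range f))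
    {B : AbelianVariety ℂ} {N : ℕ} (hB : AVDominatedBy B (X.powSucc N)) : IsDivisorGenerated B := by
  classical
  refine isDivisorGenerated_of_avDominatedBy_powSucc_of_forall_factorFamily hcm ?_ hB
  intro C _ _ K' _ _ _ Φ' A' ι' θ' hA hs hniso hslot
  have heC : ∀ c, Nonempty (K' c ≃+* (A' c).endAlgebra) := fun c =>
    nonempty_ringEquiv_endAlgebra_of_isSimple (hA c) (hs c)
  have hpos : ∀ c, 0 < (A' c).dim := fun c => by
    have h := finrank_eq_two_mul_dim_of_isCMTypeRealisation (hA c)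
    have hp : 0 < finrank ℚ (K' c) := Module.finrank_pos
    omega
  have hdim : ∀ c, (A' c).dim ≤ 3 ∨ (((A' c).dim).Prime ∧ 5 ≤ (A' c).dim) := fun c => h35 _ (hs c) (hslot c)
  have hdist' : ∀ a a', 5 ≤ (A' a).dim → 5 ≤ (A' a').dim → a ≠ a' → (A' a).dim ≠ (A' a').dim :=
    fun a a' ha ha' haa' => hdist _ _ (hs a) (hs a') (hslot a) (hslot a') ha ha' (hniso a a' haa')
  -- (i′) forbids shared imaginary quadratic subfields between ANY two slots
  have hquad : ∀ a j, a ≠ j →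
      ¬ ∃ F : IntermediateField ℚ (K' a), finrank ℚ F = 2 ∧ IsTotallyComplex F ∧ Nonempty (F →+* K' j) := by
    rintro a j haj ⟨F, hF2, hFc, ⟨g⟩⟩
    obtain ⟨ea⟩ := heC a
    obtain ⟨ej⟩ := heC j
    exact hi ⟨A' a, A' j, F, inferInstance, inferInstance, hs a, hs j, hpos a, hpos j, hslot a, hslot j, hniso a j haj,
      hFc, hF2, ⟨ea.toRingHom.comp F.val.toRingHom⟩, ⟨ej.toRingHom.comp g⟩⟩
  -- the small sub-family
  have h3S : ∀ b : {b // ¬ 5 ≤ (A' b).dim}, (A' b.1).dim ≤ 3 := fun b => by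
    rcases hdim b.1 with h | h
    · exact h
    · exact absurd h.2 b.2
  refine (isNondegenerateFamily_iff_of_primeFactors_dim_le_three hA hs hniso hdim hdist').2
    ⟨fun a j _ haj => hquad a j haj, fun i j hij => hquad i.1 j.1 fun h => hij (Subtype.ext h), ?_, ?_⟩
  · -- (ii): four small slots with one sextic field up to isomorphism would violate (ii′)
    intro a h6
    by_contra hlt
    push Not at hlt
    obtain ⟨d, hd, hdmem⟩ := exists_injective_fin_of_le_card (n := 4) (by omega : 4 ≤ _)
      (s := Finset.univ.filter fun b : {b // ¬ 5 ≤ (A' b).dim} => Nonempty (K' b.1 ≃+* K' a.1))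
    have heK : ∀ x, Nonempty (K' (d x).1 ≃+* K' a.1) := fun x => (Finset.mem_filter.1 (hdmem x)).2
    have h3d : ∀ x, (A' (d x).1).dim = 3 := fun x => by
      obtain ⟨e⟩ := heK x
      have h := finrank_eq_two_mul_dim_of_isCMTypeRealisation (hA (d x).1)
      rw [finrank_eq_of_ringEquiv'' e, h6] at h
      omega
    refine hii ⟨fun x => A' (d x).1, fun x => ⟨hs (d x).1, h3d x, hslot (d x).1⟩,
      fun x y hxy => hniso _ _ fun h => hd.ne hxy (Subtype.ext h), fun x y => ?_⟩
    obtain ⟨ex⟩ := heC (d x).1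
    obtain ⟨ey⟩ := heC (d y).1
    obtain ⟨ux⟩ := heK x
    obtain ⟨uy⟩ := heK y
    exact ⟨(ex.symm.trans (ux.trans uy.symm)).trans ey⟩
  · -- (iii): three small quartic slots with one Galois closure would violate (iii′)
    intro a h4
    by_contra hlt
    push Not at hlt
    obtain ⟨d, hd, hdmem⟩ := exists_injective_fin_of_le_card (n := 3) (by omega : 3 ≤ _)
      (s := Finset.univ.filter fun b : {b // ¬ 5 ≤ (A' b).dim} =>
        normalClosure ℚ (K' b.1) ℂ = normalClosure ℚ (K' a.1) ℂ)
    have hLK : ∀ x, normalClosure ℚ (K' (d x).1) ℂ = normalClosure ℚ (K' a.1) ℂ := fun x =>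
      (Finset.mem_filter.1 (hdmem x)).2
    have h2d : ∀ x, (A' (d x).1).dim = 2 := fun x => by
      have h := finrank_eq_two_mul_dim_of_isCMTypeRealisation (hA (d x).1)
      rw [finrank_eq_of_normalClosure_eq (K := fun b : {b // ¬ 5 ≤ (A' b).dim} => K' b.1) (fun b => hA b.1) h3S
        (i := d x) (j := a) (hLK x), h4] at h
      omega
    refine hiii ⟨fun x => A' (d x).1, fun x => ⟨hs (d x).1, h2d x, hslot (d x).1⟩,
      fun x y hxy => hniso _ _ fun h => hd.ne hxy (Subtype.ext h), fun x y => ?_⟩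
    obtain ⟨ex⟩ := heC (d x).1
    obtain ⟨ey⟩ := heC (d y).1
    change (⨆ f : (A' (d x).1).endAlgebra →+* ℂ, IntermediateField.adjoin ℚ (Set.range f)) =
      ⨆ f : (A' (d y).1).endAlgebra →+* ℂ, IntermediateField.adjoin ℚ (Set.range f)
    rw [iSup_adjoin_range_eq_normalClosure ex, iSup_adjoin_range_eq_normalClosure ey, hLK x, hLK y]

/-- **The Hodge conjecture for everything dominated by a power of a CM abelian variety whose simple isogeny factors have
dimension `≤ 3` or pairwise distinct prime dimension and satisfy (i′), (ii′), (iii′)** — all Hodge classes polynomials in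
divisor classes, UNCONDITIONALLY. [cite: MoonenZarhin1999LowDim, Thm. (0.2) (4)] [cite: Gordon1999HodgeAVSurvey, 6.3 Remark and 10.10] -/
theorem hodgeConjectureFor_of_avDominatedBy_powSucc_of_isOfCMType_of_factors_prime_or_dim_le_three (hcm : IsOfCMType X)
    (h35 : ∀ B : AbelianVariety ℂ, B.IsSimple → AVDominatedBy B X → B.dim ≤ 3 ∨ (B.dim.Prime ∧ 5 ≤ B.dim))
    (hdist : ∀ B B' : AbelianVariety ℂ, B.IsSimple → B'.IsSimple → AVDominatedBy B X → AVDominatedBy B' X →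
      5 ≤ B.dim → 5 ≤ B'.dim → ¬ IsIsogenous B B' → B.dim ≠ B'.dim)
    (hi : ¬ ∃ (B B' : AbelianVariety ℂ) (k : Type) (_ : Field k) (_ : NumberField k),
      B.IsSimple ∧ B'.IsSimple ∧ 0 < B.dim ∧ 0 < B'.dim ∧ AVDominatedBy B X ∧ AVDominatedBy B' X ∧
      ¬ IsIsogenous B B' ∧ IsTotallyComplex k ∧ finrank ℚ k = 2 ∧
      Nonempty (k →+* B.endAlgebra) ∧ Nonempty (k →+* B'.endAlgebra))
    (hii : ¬ ∃ T : Fin 4 → AbelianVariety ℂ, (∀ a, (T a).IsSimple ∧ (T a).dim = 3 ∧ AVDominatedBy (T a) X) ∧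
      (∀ a b, a ≠ b → ¬ IsIsogenous (T a) (T b)) ∧ ∀ a b, Nonempty ((T a).endAlgebra ≃+* (T b).endAlgebra))
    (hiii : ¬ ∃ S : Fin 3 → AbelianVariety ℂ, (∀ a, (S a).IsSimple ∧ (S a).dim = 2 ∧ AVDominatedBy (S a) X) ∧
      (∀ a b, a ≠ b → ¬ IsIsogenous (S a) (S b)) ∧
      ∀ a b, (⨆ f : (S a).endAlgebra →+* ℂ, IntermediateField.adjoin ℚ (Set.range f)) =
        ⨆ f : (S b).endAlgebra →+* ℂ, IntermediateField.adjoin ℚ (Set.range f))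
    {B : AbelianVariety ℂ} {N : ℕ} (hB : AVDominatedBy B (X.powSucc N)) : HodgeConjectureFor B.dim B.X :=
  hodgeConjectureFor_of_isDivisorGenerated _
    (isDivisorGenerated_of_avDominatedBy_powSucc_of_isOfCMType_of_factors_prime_or_dim_le_three hcm h35 hdist hi hii
      hiii hB)

/-- **THE CLASSIFICATION (every dimension; simple factors of dimension `≤ 3` or of pairwise distinct prime dimension).**
For a complex abelian variety `X` of CM type each of whose simple isogeny factors has dimension `≤ 3` or prime dimension,
non-isogenous prime-dimensional factors of dimension `≥ 5` having different dimensions: ALL POWERS `X^{N+1}` are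
divisor-generated IF AND ONLY IF (i′) no imaginary quadratic number field maps into the endomorphism algebras of two
non-isogenous simple isogeny factors of positive dimension, (ii′) no four pairwise non-isogenous simple threefold factors have
pairwise isomorphic endomorphism algebras, and (iii′) no three pairwise non-isogenous simple surface factors have endomorphism
fields with one intrinsic Galois closure — the conditions of the gen-44 classification, verbatim.
[cite: MoonenZarhin1999LowDim, Thms. (0.1), (0.2) and §3 (3.1), (3.9)] [cite: Gordon1999HodgeAVSurvey, §3 Theorem, 6.3 Remark, 7.5–7.7 and 9.4] -/
theorem forall_isDivisorGenerated_powSucc_iff_of_isOfCMType_of_factors_prime_or_dim_le_three (hcm : IsOfCMType X)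
    (h35 : ∀ B : AbelianVariety ℂ, B.IsSimple → AVDominatedBy B X → B.dim ≤ 3 ∨ (B.dim.Prime ∧ 5 ≤ B.dim))
    (hdist : ∀ B B' : AbelianVariety ℂ, B.IsSimple → B'.IsSimple → AVDominatedBy B X → AVDominatedBy B' X →
      5 ≤ B.dim → 5 ≤ B'.dim → ¬ IsIsogenous B B' → B.dim ≠ B'.dim) :
    (∀ N : ℕ, IsDivisorGenerated (X.powSucc N)) ↔
      (¬ ∃ (B B' : AbelianVariety ℂ) (k : Type) (_ : Field k) (_ : NumberField k),
          B.IsSimple ∧ B'.IsSimple ∧ 0 < B.dim ∧ 0 < B'.dim ∧ AVDominatedBy B X ∧ AVDominatedBy B' X ∧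
          ¬ IsIsogenous B B' ∧ IsTotallyComplex k ∧ finrank ℚ k = 2 ∧
          Nonempty (k →+* B.endAlgebra) ∧ Nonempty (k →+* B'.endAlgebra)) ∧
      (¬ ∃ T : Fin 4 → AbelianVariety ℂ, (∀ a, (T a).IsSimple ∧ (T a).dim = 3 ∧ AVDominatedBy (T a) X) ∧
          (∀ a b, a ≠ b → ¬ IsIsogenous (T a) (T b)) ∧ ∀ a b, Nonempty ((T a).endAlgebra ≃+* (T b).endAlgebra)) ∧
      (¬ ∃ S : Fin 3 → AbelianVariety ℂ, (∀ a, (S a).IsSimple ∧ (S a).dim = 2 ∧ AVDominatedBy (S a) X) ∧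
          (∀ a b, a ≠ b → ¬ IsIsogenous (S a) (S b)) ∧
          ∀ a b, (⨆ f : (S a).endAlgebra →+* ℂ, IntermediateField.adjoin ℚ (Set.range f)) =
            ⨆ f : (S b).endAlgebra →+* ℂ, IntermediateField.adjoin ℚ (Set.range f)) := by
  refine ⟨fun h => ⟨?_, ?_, ?_⟩, fun h N =>
    isDivisorGenerated_of_avDominatedBy_powSucc_of_isOfCMType_of_factors_prime_or_dim_le_three hcm h35 hdist h.1 h.2.1
      h.2.2 (AVDominatedBy.refl _)⟩
  · rintro ⟨B, B', k, _, _, hB, hB', hB0, hB'0, hBX, hB'X, hBB', hkc, hk2, ⟨j⟩, ⟨j'⟩⟩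
    haveI : IsTotallyComplex k := hkc
    obtain ⟨N, hN⟩ := exists_not_isDivisorGenerated_powSucc_of_shared_imaginary_quadratic hcm hB hB' hB0 hB'0 hBX hB'X
      hBB' hk2 j j'
    exact hN (h N)
  · rintro ⟨T, hT, hTn, hTe⟩
    obtain ⟨N, hN⟩ := exists_not_isDivisorGenerated_powSucc_of_four_threefold_factors hcm (fun a => (hT a).1)
      (fun a => (hT a).2.1) (fun a => (hT a).2.2) hTn hTe
    exact hN (h N)
  · rintro ⟨S, hS, hSn, hSe⟩
    obtain ⟨N, hN⟩ := exists_not_isDivisorGenerated_powSucc_of_three_surface_factors hcm (fun a => (hS a).1)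
      (fun a => (hS a).2.1) (fun a => (hS a).2.2) hSn hSe
    exact hN (h N)

/-- **THE DICHOTOMY.**  For `X` of CM type with simple isogeny factors of dimension `≤ 3` or of pairwise distinct prime
dimension: SOME power `X^{N+1}` carries an exotic Hodge class — a rational `(p,p)`-class outside `Dᵖ ⊗ ℂ` — iff one of the
three configurations (¬i′), (¬ii′), (¬iii′) occurs among its simple isogeny factors.  A prime-dimensional factor contributes
exotic classes ONLY by sharing an imaginary quadratic field with another factor. [cite: MoonenZarhin1999LowDim, Thms. (0.1), (0.2)]
[cite: Gordon1999HodgeAVSurvey, 7.5 and 9.4] -/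
theorem exists_not_isDivisorGenerated_powSucc_iff_of_isOfCMType_of_factors_prime_or_dim_le_three (hcm : IsOfCMType X)
    (h35 : ∀ B : AbelianVariety ℂ, B.IsSimple → AVDominatedBy B X → B.dim ≤ 3 ∨ (B.dim.Prime ∧ 5 ≤ B.dim))
    (hdist : ∀ B B' : AbelianVariety ℂ, B.IsSimple → B'.IsSimple → AVDominatedBy B X → AVDominatedBy B' X →
      5 ≤ B.dim → 5 ≤ B'.dim → ¬ IsIsogenous B B' → B.dim ≠ B'.dim) :
    (∃ (N p : ℕ) (c : complexBetti (X.powSucc N).X (2 * p)), IsRationalClass c ∧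
        IsOfHodgeType (X.powSucc N).dim (X.powSucc N).X (2 * p) p p c ∧
        c ∉ divisorClassesSpan (X.powSucc N).X (X.powSucc N).dim p) ↔
      (∃ (B B' : AbelianVariety ℂ) (k : Type) (_ : Field k) (_ : NumberField k),
          B.IsSimple ∧ B'.IsSimple ∧ 0 < B.dim ∧ 0 < B'.dim ∧ AVDominatedBy B X ∧ AVDominatedBy B' X ∧
          ¬ IsIsogenous B B' ∧ IsTotallyComplex k ∧ finrank ℚ k = 2 ∧
          Nonempty (k →+* B.endAlgebra) ∧ Nonempty (k →+* B'.endAlgebra)) ∨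
      (∃ T : Fin 4 → AbelianVariety ℂ, (∀ a, (T a).IsSimple ∧ (T a).dim = 3 ∧ AVDominatedBy (T a) X) ∧
          (∀ a b, a ≠ b → ¬ IsIsogenous (T a) (T b)) ∧ ∀ a b, Nonempty ((T a).endAlgebra ≃+* (T b).endAlgebra)) ∨
      (∃ S : Fin 3 → AbelianVariety ℂ, (∀ a, (S a).IsSimple ∧ (S a).dim = 2 ∧ AVDominatedBy (S a) X) ∧
          (∀ a b, a ≠ b → ¬ IsIsogenous (S a) (S b)) ∧
          ∀ a b, (⨆ f : (S a).endAlgebra →+* ℂ, IntermediateField.adjoin ℚ (Set.range f)) =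
            ⨆ f : (S b).endAlgebra →+* ℂ, IntermediateField.adjoin ℚ (Set.range f)) := by
  have key := forall_isDivisorGenerated_powSucc_iff_of_isOfCMType_of_factors_prime_or_dim_le_three hcm h35 hdist
  constructor
  · rintro ⟨N, p, c, hcQ, hcH, hcD⟩
    by_contra hnone
    exact hcD (key.2 ⟨fun h => hnone (Or.inl h), fun h => hnone (Or.inr (Or.inl h)),
      fun h => hnone (Or.inr (Or.inr h))⟩ N p c hcQ hcH)
  · intro hcfg
    by_contra hnone
    push Not at hnone
    have hall : ∀ N : ℕ, IsDivisorGenerated (X.powSucc N) := fun N p c hcQ hcH => hnone N p c hcQ hcH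
    obtain ⟨h1, h2, h3'⟩ := key.1 hall
    rcases hcfg with h | h | h
    · exact h1 h
    · exact h2 h
    · exact h3' h

/-- **Class-target display** (`Ring2.ClassTargets.HCOnClass`): the Hodge conjecture on the class of complex abelian varieties
dominated by a power of a CM abelian variety whose simple isogeny factors have dimension `≤ 3` or pairwise distinct prime
dimension and satisfy (i′), (ii′), (iii′).  UNCONDITIONAL. [cite: MoonenZarhin1999LowDim, Thm. (0.2) (4)] [cite: Gordon1999HodgeAVSurvey, 10.10] -/
theorem hcOnClass_avDominatedBy_powSucc_isOfCMType_factors_prime_or_dim_le_three :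
    HCOnClass fun B => ∃ (X : AbelianVariety ℂ) (N : ℕ), IsOfCMType X ∧
      (∀ B : AbelianVariety ℂ, B.IsSimple → AVDominatedBy B X → B.dim ≤ 3 ∨ (B.dim.Prime ∧ 5 ≤ B.dim)) ∧
      (∀ B B' : AbelianVariety ℂ, B.IsSimple → B'.IsSimple → AVDominatedBy B X → AVDominatedBy B' X →
        5 ≤ B.dim → 5 ≤ B'.dim → ¬ IsIsogenous B B' → B.dim ≠ B'.dim) ∧
      (¬ ∃ (B B' : AbelianVariety ℂ) (k : Type) (_ : Field k) (_ : NumberField k),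
          B.IsSimple ∧ B'.IsSimple ∧ 0 < B.dim ∧ 0 < B'.dim ∧ AVDominatedBy B X ∧ AVDominatedBy B' X ∧
          ¬ IsIsogenous B B' ∧ IsTotallyComplex k ∧ finrank ℚ k = 2 ∧
          Nonempty (k →+* B.endAlgebra) ∧ Nonempty (k →+* B'.endAlgebra)) ∧
      (¬ ∃ T : Fin 4 → AbelianVariety ℂ, (∀ a, (T a).IsSimple ∧ (T a).dim = 3 ∧ AVDominatedBy (T a) X) ∧
          (∀ a b, a ≠ b → ¬ IsIsogenous (T a) (T b)) ∧ ∀ a b, Nonempty ((T a).endAlgebra ≃+* (T b).endAlgebra)) ∧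
      (¬ ∃ S : Fin 3 → AbelianVariety ℂ, (∀ a, (S a).IsSimple ∧ (S a).dim = 2 ∧ AVDominatedBy (S a) X) ∧
          (∀ a b, a ≠ b → ¬ IsIsogenous (S a) (S b)) ∧
          ∀ a b, (⨆ f : (S a).endAlgebra →+* ℂ, IntermediateField.adjoin ℚ (Set.range f)) =
            ⨆ f : (S b).endAlgebra →+* ℂ, IntermediateField.adjoin ℚ (Set.range f)) ∧
      AVDominatedBy B (X.powSucc N) :=
  fun _ ⟨_, _, hcm, h35, hdist, hi, hii, hiii, hB⟩ =>
    hodgeConjectureFor_of_avDominatedBy_powSucc_of_isOfCMType_of_factors_prime_or_dim_le_three hcm h35 hdist hi hii hiii hB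

end PrimeOrSmall

end Summit.HodgeConjecture.CorCM

end
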